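import Summits.Ventures.LatticeQCDFlow.Exactness.AcceptanceFromMeanEnergyViolationPinsker
import Summits.Ventures.LatticeQCDFlow.Exactness.FlowSamplerSwapInvolution
import Summits.Ventures.LatticeQCDFlow.Exactness.FlowSamplerSymmetrisationKL
import HarnessLib

/-!
# The Pinsker–Jeffreys floor of the exact flow sampler: `ā ≥ 1 − √(J(π, q̃)/2)`

HONEST FRAMING: exact (Metropolis-corrected) sampling algorithms for lattice gauge theory;
figures of merit are autocorrelation/cost numbers at stated couplings and volumes; no
continuum-physics claim.  (SCALAR calibration rung S0-A: not a gauge result.)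

Venture `LatticeQCDFlow` (cell pub-lqcd), topic `Exactness`; FANOUT row 2 (`s0-phi4`, FLOW arm).
NEW WORK of the cell: the composition of `FlowSamplerSwapInvolution` (the IMH step is the swap
involution on `X × X`, `⟨ΔH⟩ = J(π, q̃) = D(π‖q̃) + D(q̃‖π)`) with GEN-24 #8's Pinsker floor for
involutions (`involutive_acceptance_ge_pinsker`); nothing is cited as a fact; no definition.  For
every flow with both relative entropies finite, the equilibrium acceptance of the exact flow sampler
satisfies **`ā ≥ 1 − √(J/2)`** — by `√2` sharper in the divergence than the one-sided Pinsker floors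
`1 − √(2D)` when the two relative entropies are comparable, and the pair (this, the Bretagnolle–Huber
form `1 − √(1 − e^{−J})` of the sibling) is the flow arm's acceptance certificate from the two KLs.

## What is proved

* **`imh_meanAccept_ge_jeffreys_pinsker`** (general space), **`phi4Flow_meanAccept_ge_jeffreys_pinsker`**;
* **`jeffreys_symmetrised_le`** — symmetrising a flow by a `w`-preserving involution never raises `J`
  (gen-22's two KL monotonicities summed), so neither Jeffreys floor can decrease under symmetrisation.
-/

namespace Summit.Ventures.LatticeQCDFlow.Exactness

open Real MeasureTheory Filter Set
open Summit.Ventures.LatticeQCDFlow.Scoring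

section General

variable {X : Type*} [MeasurableSpace X] {μ : Measure X} [SFinite μ] {w q : X → ℝ}

/-- **`ā ≥ 1 − √(J/2)`**: `w, q̃ > 0` measurable integrable, `∫ q̃ = 1`, `w log b, q̃ log b ∈ L¹`; with
`J = (∫ w log b)/Z − ∫ q̃ log b`: `∫ w(x)(∫ imhAcceptQ w q̃ x y · q̃(y)) ≥ (1 − √(J/2))·Z`. -/
theorem imh_meanAccept_ge_jeffreys_pinsker (hw0 : ∀ t, 0 < w t) (hwm : Measurable w)
    (hwi : Integrable w μ) (hq0 : ∀ t, 0 < q t) (hqm : Measurable q) (hqi : Integrable q μ)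
    (hq1 : ∫ z, q z ∂μ = 1) (hwl : Integrable (fun t => Real.log (w t / q t) * w t) μ)
    (hql : Integrable (fun t => Real.log (w t / q t) * q t) μ) :
    (1 - Real.sqrt (((∫ t, Real.log (w t / q t) * w t ∂μ) / (∫ z, w z ∂μ)
        - ∫ t, Real.log (w t / q t) * q t ∂μ) / 2)) * ∫ z, w z ∂μ
      ≤ ∫ x, w x * (∫ y, imhAcceptQ w q x y * q y ∂μ) ∂μ := by
  set H : X × X → ℝ := fun z => -Real.log (w z.1) - Real.log (q z.2) with hH
  have hHm : Measurable H :=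
    ((Real.measurable_log.comp (hwm.comp measurable_fst)).neg).sub
      (Real.measurable_log.comp (hqm.comp measurable_snd))
  have hΨμ : MeasurePreserving (Prod.swap : X × X → X × X) (μ.prod μ) (μ.prod μ) :=
    Measure.measurePreserving_swap
  have hΨi : Function.Involutive (Prod.swap : X × X → X × X) := fun p => Prod.swap_swap p
  have hZ : 0 < ∫ z, w z ∂μ := integral_pos_of_pos hw0 hwi hq1
  have hexp : Integrable (fun z => Real.exp (-H z)) (μ.prod μ) := by
    have h : Integrable (fun p : X × X => w p.1 * q p.2) (μ.prod μ) := hwi.mul_prod hqi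
    exact h.congr (Eventually.of_forall fun p => (swapEnergy_exp_neg hw0 hq0 p).symm)
  have hZH : ∫ z, Real.exp (-H z) ∂(μ.prod μ) = ∫ z, w z ∂μ := integral_exp_neg_swapEnergy hw0 hq0 hq1
  obtain ⟨hΔi, hΔ⟩ := integral_deltaH_swapEnergy hw0 hwi hq0 hqi hq1 hwl hql
  have key := involutive_acceptance_ge_pinsker (μ := μ.prod μ) hHm measurable_swap hΨi hΨμ hexp hΔi
    (by rw [hZH]; exact hZ)
  rw [hZH, hΔ] at key
  have hacc : ∫ z, min 1 (Real.exp (-deltaH H Prod.swap z)) * Real.exp (-H z) ∂(μ.prod μ)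
      = ∫ x, w x * (∫ y, imhAcceptQ w q x y * q y ∂μ) ∂μ := by
    have e : (fun z : X × X => min 1 (Real.exp (-deltaH H Prod.swap z)) * Real.exp (-H z))
        = fun z => w z.1 * (imhAcceptQ w q z.1 z.2 * q z.2) := by
      funext z
      rw [imhAcceptQ_eq_min_exp_neg_deltaH hw0 hq0 z, swapEnergy_exp_neg hw0 hq0 z]
      ring
    rw [e]
    have hint : Integrable (fun z : X × X => w z.1 * (imhAcceptQ w q z.1 z.2 * q z.2)) (μ.prod μ) := by
      refine (hwi.mul_prod hqi).mono' ?_ (Eventually.of_forall fun z => ?_)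
      · exact ((hwm.comp measurable_fst).mul
          ((measurable_imhAcceptQ hwm hqm).mul (hqm.comp measurable_snd))).aestronglyMeasurable
      · have ha := imhAcceptQ_nonneg hw0 hq0 z.1 z.2
        have ha1 := imhAcceptQ_le_one w q z.1 z.2
        rw [Real.norm_eq_abs, abs_of_nonneg (mul_nonneg (hw0 _).le (mul_nonneg ha (hq0 _).le))]
        have := mul_le_of_le_one_left (hq0 z.2).le ha1
        exact mul_le_mul_of_nonneg_left this (hw0 _).le
    rw [integral_prod _ hint]
    exact integral_congr_ae (Eventually.of_forall fun x => by
      dsimp only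
      rw [integral_const_mul])
  rw [hacc] at key
  have e2 : (∫ t, Real.log (w t / q t) * w t ∂μ - (∫ z, w z ∂μ) * ∫ t, Real.log (w t / q t) * q t ∂μ)
      / ∫ z, w z ∂μ
      = (∫ t, Real.log (w t / q t) * w t ∂μ) / (∫ z, w z ∂μ) - ∫ t, Real.log (w t / q t) * q t ∂μ := by
    field_simp
  rw [e2] at key
  exact key

omit [SFinite μ] in
/-- **SYMMETRISING A FLOW NEVER RAISES ITS JEFFREYS DIVERGENCE** (hence never lowers either Jeffreys
floor): for a measure-preserving involution `σ` with `w∘σ = w` and the symmetrised flow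
`q̃ₛ = ½(q̃ + q̃∘σ)`, `J(π, q̃ₛ) ≤ J(π, q̃)` — the sum of gen-22's `symmetrised_forwardKL_le` and
`symmetrised_reverseKL_le` (`FlowSamplerSymmetrisationKL`), in this file's normalisation
`J = (∫ w log b)/Z − ∫ q̃ log b`. -/
theorem jeffreys_symmetrised_le {σ : X → X} (hσ : MeasurePreserving σ μ μ) (hσσ : ∀ x, σ (σ x) = x)
    (hw0 : ∀ t, 0 < w t) (hwm : Measurable w) (hwi : Integrable w μ) (hw : ∀ t, w (σ t) = w t)
    (hq0 : ∀ t, 0 < q t) (hqm : Measurable q) (hqi : Integrable q μ) (hq1 : ∫ z, q z ∂μ = 1)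
    (hwl : Integrable (fun t => Real.log (w t / q t) * w t) μ)
    (hql : Integrable (fun t => Real.log (w t / q t) * q t) μ) :
    (∫ t, Real.log (w t / ((q t + q (σ t)) / 2)) * w t ∂μ) / (∫ z, w z ∂μ)
        - ∫ t, Real.log (w t / ((q t + q (σ t)) / 2)) * ((q t + q (σ t)) / 2) ∂μ
      ≤ (∫ t, Real.log (w t / q t) * w t ∂μ) / (∫ z, w z ∂μ) - ∫ t, Real.log (w t / q t) * q t ∂μ := by
  have hZ : 0 < ∫ z, w z ∂μ := integral_pos_of_pos hw0 hwi hq1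
  -- forward part
  have hKLf : Integrable (fun x => w x * Real.log (w x / q x)) μ :=
    hwl.congr (Eventually.of_forall fun x => by ring)
  obtain ⟨-, hf⟩ := symmetrised_forwardKL_le hσ hσσ hw0 hwm hwi hw hq0 hqm hqi hKLf
  have ef1 : ∫ x, w x * Real.log (w x / ((q x + q (σ x)) / 2)) ∂μ
      = ∫ t, Real.log (w t / ((q t + q (σ t)) / 2)) * w t ∂μ :=
    integral_congr_ae (Eventually.of_forall fun x => by ring)
  have ef2 : ∫ x, w x * Real.log (w x / q x) ∂μ = ∫ t, Real.log (w t / q t) * w t ∂μ :=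
    integral_congr_ae (Eventually.of_forall fun x => by ring)
  rw [ef1, ef2] at hf
  -- reverse part: `q log(q/w) = −log(w/q) q`
  have hqs0 : ∀ x, 0 < (q x + q (σ x)) / 2 := fun x => by have := hq0 x; have := hq0 (σ x); linarith
  have hlog : ∀ a b : ℝ, 0 < a → 0 < b → Real.log (a / b) = -Real.log (b / a) := fun a b ha hb => by
    rw [← Real.log_inv, inv_div]
  have hKLr : Integrable (fun x => q x * Real.log (q x / w x)) μ := by
    refine (hql.neg).congr (Eventually.of_forall fun x => ?_)
    show -(Real.log (w x / q x) * q x) = q x * Real.log (q x / w x)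
    rw [hlog (q x) (w x) (hq0 x) (hw0 x)]; ring
  obtain ⟨-, hr⟩ := symmetrised_reverseKL_le hσ hσσ hw0 hwm hwi hw hq0 hqm hqi hKLr
  have er1 : ∫ x, (q x + q (σ x)) / 2 * Real.log ((q x + q (σ x)) / 2 / w x) ∂μ
      = -∫ t, Real.log (w t / ((q t + q (σ t)) / 2)) * ((q t + q (σ t)) / 2) ∂μ := by
    rw [← integral_neg]
    refine integral_congr_ae (Eventually.of_forall fun x => ?_)
    show (q x + q (σ x)) / 2 * Real.log ((q x + q (σ x)) / 2 / w x)
      = -(Real.log (w x / ((q x + q (σ x)) / 2)) * ((q x + q (σ x)) / 2))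
    rw [hlog ((q x + q (σ x)) / 2) (w x) (hqs0 x) (hw0 x)]; ring
  have er2 : ∫ x, q x * Real.log (q x / w x) ∂μ = -∫ t, Real.log (w t / q t) * q t ∂μ := by
    rw [← integral_neg]
    refine integral_congr_ae (Eventually.of_forall fun x => ?_)
    show q x * Real.log (q x / w x) = -(Real.log (w x / q x) * q x)
    rw [hlog (q x) (w x) (hq0 x) (hw0 x)]; ring
  rw [er1, er2] at hr
  have hf' := div_le_div_of_nonneg_right hf hZ.le
  linarith

end General

section Lattice

variable {n : ℕ}

/-- **Lattice φ⁴**: `λ > 0`, real `J`, any flow with `e^{−S} log b, q̃ log b ∈ L¹`: with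
`Jf = ⟨log b⟩_S − ∫ q̃ log b`, `∫ e^{−S}(∫ imhAcceptQ e^{−S} q̃ φ φ'·q̃(φ')) ≥ (1 − √(Jf/2))·Z`. -/
theorem phi4Flow_meanAccept_ge_jeffreys_pinsker {lam : ℝ} (hlam : 0 < lam)
    (J : Fin (n + 1) → Fin (n + 1) → ℝ) {q : (Fin (n + 1) → ℝ) → ℝ} (hq0 : ∀ φ, 0 < q φ)
    (hqm : Measurable q) (hqi : Integrable q) (hq1 : ∫ φ, q φ = 1)
    (hwl : Integrable (fun φ => Real.log (gibbsWeight J lam φ / q φ) * gibbsWeight J lam φ))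
    (hql : Integrable (fun φ => Real.log (gibbsWeight J lam φ / q φ) * q φ)) :
    (1 - Real.sqrt ((gibbsExpect J lam (fun φ => Real.log (gibbsWeight J lam φ / q φ))
        - ∫ φ, Real.log (gibbsWeight J lam φ / q φ) * q φ) / 2)) * gibbsZ J lam
      ≤ ∫ φ, gibbsWeight J lam φ * (∫ φ', imhAcceptQ (gibbsWeight J lam) q φ φ' * q φ') := by
  have h := imh_meanAccept_ge_jeffreys_pinsker (μ := volume) (fun φ => gibbsWeight_pos J lam φ)
    (continuous_gibbsWeight J lam).measurable (integrable_gibbsWeight hlam J) hq0 hqm hqi hq1 hwl hql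
  unfold gibbsExpect
  exact h

end Lattice

end Summit.Ventures.LatticeQCDFlow.Exactness
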